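import Literature.Analysis.Hypoelliptic.ChartLink
import Literature.Analysis.Hypoelliptic.Smoothness
import Literature.Analysis.Hypoelliptic.FiniteOrderK
import Mathlib.Geometry.Manifold.PartitionOfUnity
import Mathlib.Analysis.InnerProductSpace.EuclideanDist
import HarnessLib

/-!
# Proof of Hörmander's hypoellipticity theorem (`Hormander1967_thm11`)

Analysis/Hypoelliptic: the assembly of the Fourier-side proof by Kohn's method
(M. E. Taylor, *Pseudodifferential Operators* (1981), Ch. XV §1) of
`Literature.Analysis.Distribution.Hormander1967_thm11` (L. Hörmander, Acta Math. 119 (1967),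
Theorem 1.1): `P = ∑ X_j² + X₀ + c` with smooth real vector fields whose iterated brackets span
at every point of `Ω` is hypoelliptic in `Ω`.

* `exists_bump`: cutoffs equal to `1` near a compact set inside an open set;
* `isHypoellipticOn_chart`: hypoellipticity in one chart `T⁻¹(ball y₀ δ)`, by the bootstrap
  `G_ζ ∈ Ĥ^t ⇒ G_ζ ∈ Ĥ^{t+ε/2}` over all cutoffs supported in a small ball
  (`KeyIdentity.inH_Pf_of_cutoff` + `Bootstrap.HData.bootstrap_step`), uniformly started by
  `FiniteOrderK.exists_fourierSide_unif`, concluded by `Smoothness.Rep.isSmoothOn` and glued by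
  `SmoothLocality.IsSmoothOn.of_locally`;
* `isHypoellipticOn_of_finrank_eq_zero`: the trivial zero-dimensional case;
* **`hormander1967_thm11_proof`** (the discharge `Hormander1967_thm11_holds` is the one-liner in
  `Literature/Analysis/Distribution/HypoellipticProofs.lean`).

## References

* L. Hörmander, *Hypoelliptic second order differential equations*, Acta Math. 119 (1967),
  Thm 1.1.
* M. E. Taylor, *Pseudodifferential Operators* (1981), Ch. XV §1.
-/

noncomputable section

open MeasureTheory Set Filter Function SchwartzMap VectorField Metric TopologicalSpace Distributions Module
open scoped Topology ComplexConjugate InnerProductSpace BigOperators ContDiff Manifold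

namespace Literature.Analysis.Hypoelliptic

open Literature.Analysis.Distribution

/-! ### Bumps -/

section Bumps

variable {E : Type*} [NormedAddCommGroup E] [NormedSpace ℝ E] [FiniteDimensional ℝ E]

/-- **A cutoff equal to `1` on a compact set `K` and supported in an open set `U ⊇ K`.** [folklore] -/
theorem exists_bump {K U : Set E} (hK : IsCompact K) (hU : IsOpen U) (hKU : K ⊆ U) :
    ∃ f : E → ℝ, ContDiff ℝ ∞ f ∧ HasCompactSupport f ∧ tsupport f ⊆ U ∧ ∀ x ∈ K, f x = 1 := by
  obtain ⟨W, hWo, hKW, hWU, hWc⟩ := exists_open_between_and_isCompact_closure hK hU hKU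
  have hKi : K ⊆ interior (closure W) := hKW.trans (interior_maximal subset_closure hWo)
  obtain ⟨f, hf1, hf0, _⟩ := exists_contMDiffMap_one_nhds_of_subset_interior 𝓘(ℝ, E) (n := (⊤ : ℕ∞)) hK.isClosed hKi
  have hfs : ContDiff ℝ ∞ f := f.contMDiff.contDiff
  have hsupp : Function.support f ⊆ closure W := fun x hx => by
    by_contra h; exact hx (hf0 x h)
  have htsupp : tsupport f ⊆ closure W := by
    simpa [tsupport, closure_closure] using closure_mono hsupp
  refine ⟨f, hfs, IsCompact.of_isClosed_subset hWc (isClosed_tsupport _) htsupp, htsupp.trans hWU,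
    fun x hx => ?_⟩
  exact hf1.self_of_nhdsSet x hx

end Bumps

/-! ### One chart -/

section OneChart

variable {E : Type*} [NormedAddCommGroup E] [NormedSpace ℝ E] [FiniteDimensional ℝ E]
  [MeasurableSpace E] [BorelSpace E] (μ : Measure E) [μ.IsAddHaarMeasure]
variable {V : Type*} [NormedAddCommGroup V] [InnerProductSpace ℝ V] [FiniteDimensional ℝ V]
  [MeasurableSpace V] [BorelSpace V]
variable {ι : Type*} [Fintype ι] {X₀ : E → E} {X : ι → E → E} {c : E → ℝ}

/-- **Hypoellipticity in one chart.** [folklore] -/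
theorem isHypoellipticOn_chart (hX₀ : ContDiff ℝ ∞ X₀) (hX : ∀ j, ContDiff ℝ ∞ (X j)) (hc : ContDiff ℝ ∞ c)
    (T : E ≃L[ℝ] V) {K : ℕ} (C : Chart V K) {m : ℕ} (S : C.SpanIn m) (eK : ι ≃ Fin K)
    (hXV : ∀ i, C.XV i = push T (X (eK.symm i))) (hXV0 : C.XV0 = push T X₀) (hcV : C.cV = fun y => c (T.symm y))
    {Ω' : Opens E} (hΩ' : (Ω' : Set E) ⊆ T ⁻¹' ball C.y₀ C.δ) :
    IsHypoellipticOn Ω' (hormanderTranspose X₀ X c) μ := by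
  intro u U hU hUΩ' hPu
  obtain ⟨f, hfU, hfu⟩ := hPu
  -- the Fourier-side data
  set d : HData V := C.g.d with hd
  have hL := C.spanHyp S
  set ε : ℝ := d.epsOf (fun k => (C.spanData S k).L) with hε
  have hε0 : 0 < ε := d.epsOf_pos _
  have hP : ∀ G, d.opP.apply G = C.g.fd.Pf G := C.g.apply_opP
  have hXs : ∀ j G, (d.Xs j).apply G = C.g.fd.Xf j G := C.g.apply_Xs
  -- change of variables
  obtain ⟨cT, hcT, hT⟩ := exists_integral_comp_eq μ T
  have hT' : ∀ g : V → ℂ, ∫ x, g ((T : E →L[ℝ] V) x) ∂μ = (cT : ℂ) * ∫ y, g y := hT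
  -- locality
  refine IsSmoothOn.of_locally (μ := μ) hUΩ' fun x hx => ?_
  obtain ⟨r, hr, hrU⟩ := Metric.isOpen_iff.1 hU x hx
  set ρ : ℝ := r / 4 with hρ
  have hρ0 : 0 < ρ := by rw [hρ]; positivity
  have h3ρ : closedBall x (3 * ρ) ⊆ U := (closedBall_subset_ball (by rw [hρ]; linarith)).trans hrU
  have h2ρU : ball x (2 * ρ) ⊆ U := (ball_subset_closedBall.trans (closedBall_subset_closedBall (by linarith))).trans h3ρ
  have hK2 : (closedBall x (2 * ρ) : Set E) ⊆ Ω' := ((closedBall_subset_closedBall (by linarith)).trans h3ρ).trans hUΩ'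
  refine ⟨ball x ρ, isOpen_ball, mem_ball_self hρ0,
    (ball_subset_closedBall.trans (closedBall_subset_closedBall (by linarith))).trans h3ρ, ?_⟩
  -- uniform Fourier sides for cutoffs supported in `closedBall x 2ρ`
  obtain ⟨M, hM⟩ := exists_fourierSide_unif u ⟨closedBall x (2 * ρ), isCompact_closedBall x _⟩ hK2 (T : E →L[ℝ] V)
  choose G hGin hGpair using hM
  -- `G ζ _` represents the identity
  have hRep : ∀ (ζ : 𝓓(Ω', ℝ)) (hζ : tsupport (ζ : E → ℝ) ⊆ closedBall x (2 * ρ)),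
      Rep u ζ (T : E →L[ℝ] V) (G ζ hζ) id := fun ζ hζ =>
    ⟨⟨-M, hGin ζ hζ⟩, fun h hh => hh, fun _ _ _ _ => rfl, fun _ _ _ => rfl, fun ψ => by
      rw [hGpair ζ hζ ψ, fourierFun_eq_uC]; rfl⟩
  -- the bootstrap over cutoffs supported in the OPEN ball `ball x 2ρ`
  have hbs : ∀ {ζ : 𝓓(Ω', ℝ)} (hζ : tsupport (ζ : E → ℝ) ⊆ ball x (2 * ρ)),
      tsupport (ζ : E → ℝ) ⊆ closedBall x (2 * ρ) := fun hζ => hζ.trans ball_subset_closedBall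
  have hlevel : ∀ N : ℕ, ∀ (ζ : 𝓓(Ω', ℝ)) (hζ : tsupport (ζ : E → ℝ) ⊆ ball x (2 * ρ)),
      InH (-M - 1 + N * (ε / 2)) (G ζ (hbs hζ)) ∧ ∀ j, InH (-M - 1 + N * (ε / 2)) (C.g.fd.Xf j (G ζ (hbs hζ))) := by
    intro N
    induction N with
    | zero =>
      intro ζ hζ
      simp only [Nat.cast_zero, zero_mul, add_zero]
      exact ⟨(hGin ζ _).mono (by linarith), fun j => (C.g.fd.X j).inH_applyF FlatHData.bas (hGin ζ _)⟩
    | succ N ih =>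
      intro ζ hζ
      set t : ℝ := -M - 1 + N * (ε / 2) with ht
      -- a cutoff `ζ' = 1` on `tsupport ζ`, supported in the ball
      obtain ⟨η, hηs, hηc, hηsupp, hη1⟩ := exists_bump ζ.hasCompactSupport isOpen_ball hζ
      let ζ' : 𝓓(Ω', ℝ) := ⟨η, hηs, hηc, hηsupp.trans ((ball_subset_closedBall).trans hK2)⟩
      have hζ' : tsupport (ζ' : E → ℝ) ⊆ ball x (2 * ρ) := hηsupp
      have hζζ : ∀ z, ζ' z * ζ z = ζ z := fun z => by
        by_cases hz : z ∈ tsupport (ζ : E → ℝ)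
        · rw [show (ζ' : E → ℝ) z = η z from rfl, hη1 z hz, one_mul]
        · rw [image_eq_zero_of_notMem_tsupport hz, mul_zero]
      obtain ⟨hG', hXG'⟩ := ih ζ' hζ'
      obtain ⟨hGζ, hXGζ⟩ := ih ζ hζ
      -- avatars
      set xl := C.xl T with hxl
      have havη : ∀ j, ∃ b : 𝓢(V, ℂ), ∀ z, ((xl.Xap j ζ z : ℝ) : ℂ) = b (T z) := fun j =>
        (exists_avatar_real T (xl.contDiff_Xap j ζ.contDiff) (xl.hasCompactSupport_Xap j ζ.hasCompactSupport)).imp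
          fun q hq => hq.1
      choose bη hbη using havη
      obtain ⟨bm, hbm, -⟩ := exists_avatar_real T (xl.contDiff_mcoef ζ.contDiff) (xl.hasCompactSupport_mcoef ζ.hasCompactSupport)
      have hfζs : ContDiff ℝ ∞ fun z => f z * ζ z := by
        have := contDiff_cutoff_mul' ζ.contDiff (U := U) (hζ.trans h2ρU) fun y hy => hfU.contDiffAt (hU.mem_nhds hy)
        simpa only [mul_comm] using this
      obtain ⟨q, hq, -⟩ := exists_avatar_real T hfζs (ζ.hasCompactSupport.mul_left)
      -- the hypothesis `P u = f` in the form of the key identity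
      have hPu' : ∀ g : E → ℂ, ContDiff ℝ ∞ g →
          uC u ζ' (xl.PfC (mulC ζ g)) = ∫ z, ((f z * ζ z : ℝ) : ℂ) * g z ∂μ := fun g hg =>
        C.hPu T μ eK hXV hXV0 hcV hX₀ hX hc hΩ' hU hfU.continuousOn hfu (hζ.trans h2ρU)
          (fun z hz => hη1 z hz) hg
      -- the key identity gives `Pf G_ζ ∈ Ĥ^t`
      have hPf : InH t (C.g.fd.Pf (G ζ (hbs hζ))) :=
        xl.inH_Pf_of_cutoff (hRep ζ _) (hRep ζ' _) hζζ bη hbη bm hbm (μ := μ)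
          (Fζ := fun z => ((f z * ζ z : ℝ) : ℂ)) hPu' hq hT' hG' hXG'
      -- bootstrap
      have hb := HData.bootstrap_step d hL C.g.fd hP hXs hGζ hXGζ hPf
      have e1 : -M - 1 + ((N + 1 : ℕ) : ℝ) * (ε / 2) = t + ε / 2 := by push_cast; rw [ht]; ring
      rw [e1]
      exact ⟨hb.1.mono (by linarith), hb.2⟩
  -- all `G ζ` are `Nice`
  have hNice : ∀ (ζ : 𝓓(Ω', ℝ)) (hζ : tsupport (ζ : E → ℝ) ⊆ ball x (2 * ρ)), Nice (G ζ (hbs hζ)) := by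
    intro ζ hζ
    refine ⟨(hGin ζ _).1, fun t => ?_⟩
    obtain ⟨N, hN⟩ := exists_nat_gt ((t + M + 1) / (ε / 2))
    have hle : t ≤ -M - 1 + N * (ε / 2) := by
      have h2 : (t + M + 1) / (ε / 2) * (ε / 2) = t + M + 1 := div_mul_cancel₀ _ (by linarith)
      nlinarith [hN, h2, hε0]
    exact ((hlevel N ζ hζ).1.mono hle).2
  -- the final cutoff, `= 1` on `ball x ρ`
  obtain ⟨η₁, hη₁s, hη₁c, hη₁supp, hη₁1⟩ := exists_bump (isCompact_closedBall x ρ) isOpen_ball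
    (closedBall_subset_ball (by linarith : ρ < 2 * ρ))
  let ζ₁ : 𝓓(Ω', ℝ) := ⟨η₁, hη₁s, hη₁c, hη₁supp.trans ((ball_subset_closedBall).trans hK2)⟩
  have hζ₁ : tsupport (ζ₁ : E → ℝ) ⊆ ball x (2 * ρ) := hη₁supp
  haveI : SigmaFinite μ := by infer_instance
  exact Rep.isSmoothOn (hRep ζ₁ (hbs hζ₁)) (hNice ζ₁ hζ₁) (Complex.ofReal_ne_zero.2 hcT) hT'
    (fun φ => (exists_avatar_real T φ.contDiff φ.hasCompactSupport).imp fun q hq => hq.1)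
    (fun z hz => hη₁1 z (ball_subset_closedBall hz))

end OneChart

/-! ### Charts exist around every point (positive dimension) -/

section Charts

variable {E : Type*} [NormedAddCommGroup E] [NormedSpace ℝ E] [FiniteDimensional ℝ E]
  [MeasurableSpace E] [BorelSpace E] (μ : Measure E) [μ.IsAddHaarMeasure]
variable {V : Type*} [NormedAddCommGroup V] [InnerProductSpace ℝ V] [FiniteDimensional ℝ V]
  [MeasurableSpace V] [BorelSpace V]
variable {ι : Type*} [Fintype ι] {X₀ : E → E} {X : ι → E → E} {c : E → ℝ}

/-- **Around every point of `Ω` there is a chart in which `P` is hypoelliptic** (positive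
dimension). [folklore] -/
theorem exists_chart_nhds (hX₀ : ContDiff ℝ ∞ X₀) (hX : ∀ j, ContDiff ℝ ∞ (X j)) (hc : ContDiff ℝ ∞ c)
    {Ω : Opens E} (hgen : IsBracketGenerating (fun o : Option ι => o.elim X₀ X) (Ω : Set E))
    (T : E ≃L[ℝ] V) (hpos : finrank ℝ V ≠ 0) {x₀ : E} (hx₀ : x₀ ∈ Ω) :
    ∃ Ω' : Opens E, x₀ ∈ Ω' ∧ Ω' ≤ Ω ∧ IsHypoellipticOn Ω' (hormanderTranspose X₀ X c) μ := by
  -- indices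
  set K : ℕ := Fintype.card ι with hK
  set eK : ι ≃ Fin K := Fintype.equivFin ι with heK
  set n : ℕ := finrank ℝ V with hn
  -- the `E`-side fields indexed by `Fin (K + n)` (zero beyond `K`)
  set XJ : Fin (K + n) → E → E := Fin.append (fun i => X (eK.symm i)) (fun _ _ => 0) with hXJ
  have hXJs : ∀ j, ContDiff ℝ ∞ (XJ j) := by
    intro j
    refine Fin.addCases (fun i => ?_) (fun l => ?_) j
    · simp only [hXJ, Fin.append_left]; exact hX _
    · simp only [hXJ, Fin.append_right]; exact contDiff_const
  set emb : ι → Fin (K + n) := fun i => Fin.castAdd n (eK i) with hemb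
  have hembX : ∀ i, XJ (emb i) = X i := fun i => by simp [hXJ, hemb]
  -- spanning words at `x₀`
  obtain ⟨m, w, hwidx, hspan⟩ := exists_spanning_words (X₀ := X₀) (XJ := XJ) emb hembX hx₀ hgen
  have hlow : ∀ i, LowIdx (w i) := fun i =>
    (hwidx i).mono (fun j hj => by obtain ⟨i', rfl⟩ := hj; simp [hemb]) (w i)
  -- the `V`-side fields and the word brackets without cutoffs
  set XVf : Fin K → V → V := fun i => push T (X (eK.symm i)) with hXVf
  set XV0 : V → V := push T X₀ with hXV0
  have hXVs : ∀ i, ContDiff ℝ ∞ (XVf i) := fun i => contDiff_push T (hX _)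
  have hXV0s : ContDiff ℝ ∞ XV0 := contDiff_push T hX₀
  set XBz : Fin (K + n) → V → V := Fin.append XVf (fun _ _ => 0) with hXBz
  have hXBzs : ∀ j, ContDiff ℝ ∞ (XBz j) := by
    intro j
    refine Fin.addCases (fun i => ?_) (fun l => ?_) j
    · simp only [hXBz, Fin.append_left]; exact hXVs _
    · simp only [hXBz, Fin.append_right]; exact contDiff_const
  set Zf : Fin m → V → V := fun i => vbr XBz XV0 (w i) with hZf
  have hZs : ∀ i, ContDiff ℝ ∞ (Zf i) := fun i => contDiff_vbr hXBzs hXV0s (w i)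
  have hpush : (fun j => push T (XJ j)) = XBz := by
    funext j
    refine Fin.addCases (fun i => ?_) (fun l => ?_) j
    · simp [hXJ, hXBz, hXVf]
    · ext y; simp [hXJ, hXBz, push]
  have hZy₀ : ∀ i, Zf i (T x₀) = T (ebr X₀ XJ (w i) x₀) := by
    intro i
    have : Zf i = push T (ebr X₀ XJ (w i)) := by
      rw [push_ebr T hX₀ hXJs (w i), hpush]
    rw [this, push_apply]
  have hspanV : Submodule.span ℝ (Set.range fun i => Zf i (T x₀)) = ⊤ := by
    have e : (Set.range fun i => Zf i (T x₀)) =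
        ((T : E →ₗ[ℝ] V) : E → V) '' Set.range (fun i => ebr X₀ XJ (w i) x₀) := by
      ext v
      simp only [Set.mem_range, Set.mem_image, hZy₀]
      constructor
      · rintro ⟨i, rfl⟩; exact ⟨_, ⟨i, rfl⟩, rfl⟩
      · rintro ⟨_, ⟨i, rfl⟩, rfl⟩; exact ⟨i, rfl⟩
    rw [e, Submodule.span_image, hspan, Submodule.map_top, LinearMap.range_eq_top]
    exact T.surjective
  -- Gram coefficients
  obtain ⟨δ₀, hδ₀, gcoef, hgs, hgsum⟩ := exists_gram hZs hspanV (FlatHData.bas (V := V))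
  -- the radius
  have hΩo : IsOpen ((T : E → V) '' (Ω : Set E)) := T.toHomeomorph.isOpenMap _ Ω.isOpen
  obtain ⟨r, hr, hrΩ⟩ := Metric.isOpen_iff.1 hΩo (T x₀) ⟨x₀, hx₀, rfl⟩
  set δ : ℝ := min r δ₀ / 5 with hδdef
  have hmin : 0 < min r δ₀ := lt_min hr hδ₀
  have hδ : 0 < δ := by rw [hδdef]; positivity
  have h4 : 4 * δ < r := by
    have := min_le_left r δ₀; rw [hδdef]; linarith
  have h2 : 2 * δ < δ₀ := by
    have := min_le_right r δ₀; rw [hδdef]; linarith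
  -- the chart and its spanning data
  let C : Chart V K :=
    { XV := XVf, XV0 := XV0, cV := fun y => c (T.symm y), hXV := hXVs, hXV0 := hXV0s,
      hcV := hc.comp T.symm.contDiff, y₀ := T x₀, δ := δ, hδ := hδ, pos := hpos }
  let S : C.SpanIn m :=
    { w := w, low := hlow, δ₀ := δ₀, gcoef := gcoef, hsmooth := hgs, hsum := hgsum, hδ₀ := h2 }
  -- the chart neighbourhood
  let Ω' : Opens E := ⟨T ⁻¹' ball (T x₀) δ, isOpen_ball.preimage T.continuous⟩
  refine ⟨Ω', by show x₀ ∈ T ⁻¹' ball (T x₀) δ; simp [hδ], fun x hx => ?_,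
    isHypoellipticOn_chart μ hX₀ hX hc T C S eK (fun _ => rfl) rfl rfl subset_rfl⟩
  -- `Ω' ≤ Ω`
  have hx' : T x ∈ ball (T x₀) r := ball_subset_ball (by linarith) (show T x ∈ ball (T x₀) δ from hx)
  obtain ⟨x', hx'Ω, hTx'⟩ := hrΩ hx'
  have : x' = x := T.injective hTx'
  rwa [← this]

end Charts

/-! ### Dimension zero -/

section DimZero

variable {E : Type*} [NormedAddCommGroup E] [NormedSpace ℝ E] [MeasurableSpace E]

/-- On a one-point space every distribution is a smooth function. [folklore] -/
theorem isHypoellipticOn_of_subsingleton [Subsingleton E] (Ω : Opens E) (tP : (E → ℝ) → E → ℝ)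
    (μ : Measure E) [IsFiniteMeasureOnCompacts μ] [μ.IsOpenPosMeasure] : IsHypoellipticOn Ω tP μ := by
  intro u U _ hUΩ _
  by_cases hUe : U = ∅
  · refine ⟨fun _ => 0, contDiffOn_const, fun φ hφ => ?_⟩
    have h0 : φ = 0 := by
      ext x
      have hx : x ∉ tsupport (φ : E → ℝ) := fun h => by simpa [hUe] using hφ h
      exact image_eq_zero_of_notMem_tsupport hx
    simp [h0]
  · obtain ⟨x₀, hx₀⟩ := Set.nonempty_iff_ne_empty.2 hUe
    haveI : Finite E := Finite.of_subsingleton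
    have hΩ : ∀ y : E, y ∈ (Ω : Set E) := fun y => (Subsingleton.elim x₀ y) ▸ hUΩ hx₀
    -- the constant test function `1`
    let one : 𝓓(Ω, ℝ) := ⟨fun _ => 1, contDiff_const,
      IsCompact.of_isClosed_subset isCompact_univ (isClosed_tsupport _) (subset_univ _), fun y _ => hΩ y⟩
    set mass : ℝ := μ.real univ with hmass
    have hmass0 : mass ≠ 0 := by
      rw [hmass, Measure.real, ENNReal.toReal_ne_zero]
      exact ⟨isOpen_univ.measure_ne_zero μ univ_nonempty, (isCompact_univ.measure_lt_top (μ := μ)).ne⟩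
    refine ⟨fun _ => u one / mass, contDiffOn_const, fun φ _ => ?_⟩
    have hφ : φ = φ x₀ • one := by
      ext y
      rw [Subsingleton.elim y x₀]
      show φ x₀ = φ x₀ * 1
      ring
    have hint : (fun y => u one / mass * φ y) = fun _ => u one / mass * φ x₀ := by
      ext y; rw [Subsingleton.elim y x₀]
    rw [hint, integral_const, smul_eq_mul, ← hmass]
    conv_lhs => rw [hφ]
    rw [map_smul, smul_eq_mul]
    field_simp

end DimZero

/-! ### The theorem -/

/-- **Hörmander's hypoellipticity theorem** (Hörmander 1967, Thm 1.1), proved by Kohn's method on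
the Fourier side (Taylor 1981, Ch. XV §1): the named fact
`Literature.Analysis.Distribution.Hormander1967_thm11` holds. [cite: Hormander1967, Thm 1.1] -/
theorem hormander1967_thm11_proof : Hormander1967_thm11 := by
  intro E _ _ _ _ _ μ _ ι _ Ω X₀ X c hX₀ hX hc hgen
  by_cases hn : finrank ℝ E = 0
  · haveI : Subsingleton E := Module.finrank_zero_iff.1 hn
    exact isHypoellipticOn_of_subsingleton Ω _ μ
  · refine IsHypoellipticOn.of_locally fun x₀ hx₀ => ?_
    have hpos : finrank ℝ (EuclideanSpace ℝ (Fin (finrank ℝ E))) ≠ 0 := by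
      rw [finrank_euclideanSpace_fin]; exact hn
    exact exists_chart_nhds μ hX₀ hX hc hgen toEuclidean hpos hx₀

end Literature.Analysis.Hypoelliptic

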